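import Literature.MathematicalPhysics.QuantumLattice.FockFirstQuantization
import Literature.MathematicalPhysics.QuantumLattice.HyperoctahedralFockAction
import HarnessLib

/-!
# Second quantisation `Γ(f)` of an orbital map on the Jordan–Wigner Fock space

Topic `MathematicalPhysics/QuantumLattice`; definition request `defn-fockMapOp` (route
HubbardSuperconductivity/PositivityPins, items `AttrB1gPseudoGap`, `TraceLemma`, which write the
operator inline). For finite linearly ordered orbital sets `ι`, `κ` and ANY map `f : ι → κ`
(typically a bijection: a lattice symmetry acting on the Hubbard orbitals `Orb Λ = Λ ×ₗ Fin 2`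
through the site — the point group `d4Orb γ` of `PairCorrelations`, a torus translation) we define

  `fockMapOp f : Matrix (Finset κ) (Finset ι) ℂ`,
  column `t = {t₀ < ⋯ < t_{k-1}}` ↦ `c†_{f t₀} ⋯ c†_{f t_{k-1}} |∅⟩ = ε_f(t) · |f '' t⟩`

between the concrete Fock spaces `Fock ι = (Finset ι → ℂ)` → `Fock κ` of `HubbardWave0`
(`creation`, `annihilation`, `vacuum`, Jordan–Wigner signs), where `ε_f(t) ∈ {±1}` is the sign
of the permutation sorting `(f t₀, …, f t_{k-1})` and `ε_f(t) = 0` if `f` is not injective on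
`t`. This is the **second quantisation** `Γ(p_f)` (Dereziński–Gérard, Def. 3.20/3.34:
`Γ(p) = ⊕ₙ p^{⊗ n}` restricted to the antisymmetric Fock space; Bratteli–Robinson II §5.2.1) of
the one-particle map `p_f : ℂ^ι → ℂ^κ, e_i ↦ e_{f i}` (`oneParticleMap f`), i.e. the
exterior-power functor `⋀ p_f` read in the occupation basis; for a permutation of the sites of
a Hubbard chain it is the site-permutation / shift operator of Essler et al. §2.2.1–2.2.2
(Heilmann–Lieb), characterised by `P c†_i = c†_{π i} P`.

## Main results (all proved; no named facts)

* `fockExteriorEquiv_fockMapOp_mulVec`: under the tree's identification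
  `fockExteriorEquiv : Fock ι ≃ₗ ⋀ ℂ^ι`, `fockMapOp f` is Mathlib's `ExteriorAlgebra.map p_f`.
* functoriality `fockMapOp_comp : Γ(g ∘ f) = Γ(g) Γ(f)`, `fockMapOp_id : Γ(id) = 1` for ALL maps
  (Dereziński–Gérard Prop. 3.23 (1)); `fockMapOp_mulVec_prodCreation_vacuum :
  Γ(f) C†(o)|∅⟩ = C†(f ∘ o)|∅⟩` for every (not necessarily increasing) string `o`.
* `fockMapOp_mul_creation : Γ(f) c†_i = c†_{f i} Γ(f)` for every `f`
  (Dereziński–Gérard Prop. 3.53 (1), `Γ(p) a*(w) = a*(p w) Γ(p)`; Essler et al. (2.35), (2.41)).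
* columns: `± |f '' t⟩` when `f` is injective on `t`, `0` otherwise (Pauli); `Γ(f)` is an
  isometry for injective `f` (`conjTranspose_fockMapOp_mul_self`) and unitary for bijective `f`
  (`fockMapOp_mul_conjTranspose_self`, `fockMapOp_mem_unitaryGroup`, `conjTranspose_fockMapOp :
  Γ(e)ᴴ = Γ(e⁻¹)`; "`Γ(p)` is unitary iff `p` is"), whence
  `Γ c†_i Γᴴ = c†_{f i}`, `Γ c_i Γᴴ = c_{f i}`, `Γ c_i = c_{f i} Γ` for bijections.
* `Γ(f)` preserves the particle number (`IsNParticle.fockMapOp_mulVec`,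
  `fockMapOp_mul_totalNumberOp`).
* **`fockMapOp_equiv : fockMapOp ⇑e = relabelMatrix e`** for an equivalence `e` — the tree's
  signed permutation matrix `|t⟩ ↦ ε_e(t)|e t⟩` (`HyperoctahedralFockAction`,
  `FermionRelabelling`), by the uniqueness principle `eq_one_of_commute_creation_of_mulVec_vacuum`;
  so `prodCreation (e ∘ t↑)|∅⟩ = relabelSign e t • |e t⟩` (`prodCreation_equiv_orderEmbOfFin_vacuum`)
  and `relabel e a = Γ a Γᴴ` (`relabel_eq_fockMapOp_mul`).
* Hubbard model, site bijection `f : Λ ≃ Λ'` (`Orb.mapEquiv f`): `Γ H_G(t,U) = H_{G'}(t,U) Γ`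
  for `f` carrying `G` onto `G'` (`fockMapOp_mapEquiv_mul_hamiltonian`, from
  `relabel_hamiltonian`), `Γ N = N Γ`, `Γ S^z = S^z Γ`, `Γ (szSector N M) ⊆ szSector N M`, and
  for an automorphism `Γ` maps `(N, S^z = M)`-sector ground states to sector ground states
  (`IsGroundStateInSector.fockMapOp_mapEquiv_mulVec`).

## Mathlib / tree search; why a separate definition

Mathlib: `ExteriorAlgebra.map`, `map_comp_map`, `map_apply_ιMulti`, `Fintype.linearCombination`,
`Matrix.unitaryGroup`; no Fock space / second quantisation. Tree: `FirstQuant.prodCreation`,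
`prodCreation_vacuum_perm`, `prodCreation_orderEmbOfFin_vacuum`, `fockExteriorEquiv`,
`creation_eq_wedge_holds` (`FockFirstQuantization`, `FermionOperators`); `jwEmbed`
(`FermionEmbedding`: ORDER embeddings only); `relabelSign`, `relabel e`, `Orb.mapEquiv`,
`relabel_hamiltonian` (`FermionRelabelling`) and `relabelMatrix e` (`HyperoctahedralFockAction`) —
the signed permutation matrix of an `Equiv`, defined by its sign formula. `fockMapOp` is NOT a
restatement of `relabelMatrix`: it is defined for arbitrary maps between possibly different
orbital types by the creation-string formula that the route statements contain verbatim
(`fockMapOp (d4Orb γ)` unfolds to the route text by `rfl`, `fockMapOp_def`; `d4Orb γ` is a plain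
function, not an `Equiv`), its functoriality and `c†`-intertwining hold for non-injective maps,
and on equivalences it is PROVED equal to `relabelMatrix` (`fockMapOp_equiv`), so no API is
duplicated: the bijective theory is imported from `relabel`/`relabelMatrix`.

## Not here

The action on Lieb's coefficient matrix (`liebW n (Γ ψ) = M · liebW n ψ · Mᵀ` with one signed
permutation matrix `M` on `Config Λ n`), and the torus point group `D₄` as graph automorphisms
of `fermionTorusGraph 2 L` (so that `fockMapOp (d4Orb γ)` commutes with `hubbardTorus 2 L t U`):
follow-ups on top of `fockMapOp_mapEquiv_mul_hamiltonian`.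

## References

* J. Dereziński, C. Gérard, *Mathematics of Quantization and Quantum Fields*, CUP (2013/2022),
  Def. 3.20, Prop. 3.23, Def. 3.34, Prop. 3.36, Prop. 3.53 (held: `book:derezinski2022-…`,
  PDF pp. 93–94, 96–97, 103). [DerezinskiGerard2022]
* F. H. L. Essler, H. Frahm, F. Göhmann, A. Klümper, V. E. Korepin, *The One-Dimensional Hubbard
  Model*, CUP 2005, §2.2.1 eqs. (2.32)–(2.39), §2.2.2 eqs. (2.40)–(2.47) (held, PDF pp. 58–59).
  [EsslerEtAl2005]
* O. Bratteli, D. W. Robinson, *Operator Algebras and Quantum Statistical Mechanics II*,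
  §5.2.1–5.2.2, Thm. 5.2.5 (second quantisation on the antisymmetric Fock space; unitary
  implementation of one-particle unitaries). [BratteliRobinsonII1997]
-/

noncomputable section

namespace Literature.MathematicalPhysics.QuantumLattice

open Matrix Finset

section General

variable {ι κ μ : Type*} [LinearOrder ι] [Fintype ι] [LinearOrder κ] [Fintype κ]
  [LinearOrder μ] [Fintype μ]

/-- **Second quantisation of an orbital map.** For `f : ι → κ`, the operator
`Γ(f) : Fock ι → Fock κ` whose column at the occupation basis vector `|t⟩`,
`t = {t₀ < ⋯ < t_{k-1}}`, is `c†_{f t₀} c†_{f t₁} ⋯ c†_{f t_{k-1}} |∅⟩` — the image of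
`|t⟩ = c†_{t₀} ⋯ c†_{t_{k-1}} |∅⟩` when every `c†_i` is replaced by `c†_{f i}`. It equals
`ε_f(t) |f '' t⟩` with `ε_f(t)` the sign of the permutation sorting `(f t₀, …, f t_{k-1})`
(`0` if `f` is not injective on `t`), and is the restriction `Γ(p_f) = ⊕ₖ ⋀ᵏ p_f` of the
exterior-power functor of the one-particle map `p_f e_i = e_{f i}` to the antisymmetric Fock
space (Dereziński–Gérard Def. 3.20/3.34; Bratteli–Robinson II §5.2.1); for a site permutation
of a Hubbard lattice it is the permutation/shift operator of Essler et al. §2.2.1–2.2.2.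
[cite: DerezinskiGerard2022, Def. 3.20 and Def. 3.34] -/
def fockMapOp (f : ι → κ) : Matrix (Finset κ) (Finset ι) ℂ :=
  Matrix.of fun s t =>
    (FirstQuant.prodCreation (fun l : Fin t.card => f (t.orderEmbOfFin rfl l)) *ᵥ
      (vacuum : Fock κ)) s

omit [Fintype ι] in
/-- Unfolding `fockMapOp` to the inline term used in route files (definitional). [folklore] -/
theorem fockMapOp_def (f : ι → κ) :
    fockMapOp f = Matrix.of fun (s : Finset κ) (t : Finset ι) =>
      (FirstQuant.prodCreation (fun l : Fin t.card => f (t.orderEmbOfFin rfl l)) *ᵥ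
        (vacuum : Fock κ)) s :=
  rfl

omit [Fintype ι] in
/-- Entries of `Γ(f)`: `⟨s| Γ(f) |t⟩ = ⟨s| c†_{f t₀} ⋯ c†_{f t_{k-1}} |∅⟩`. [folklore] -/
theorem fockMapOp_apply (f : ι → κ) (s : Finset κ) (t : Finset ι) :
    fockMapOp f s t =
      (FirstQuant.prodCreation (fun l : Fin t.card => f (t.orderEmbOfFin rfl l)) *ᵥ
        (vacuum : Fock κ)) s :=
  rfl

/-- The column of `Γ(f)` at `|t⟩` is the creation string `c†_{f t₀} ⋯ c†_{f t_{k-1}} |∅⟩` of the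
image of the increasing enumeration of `t`. [cite: EsslerEtAl2005, §2.2.1 eq. (2.35)] -/
theorem fockMapOp_mulVec_single (f : ι → κ) (t : Finset ι) :
    fockMapOp f *ᵥ (Pi.single t 1 : Fock ι) =
      FirstQuant.prodCreation (fun l : Fin t.card => f (t.orderEmbOfFin rfl l)) *ᵥ
        (vacuum : Fock κ) := by
  ext s
  rw [Matrix.mulVec_single_one]
  rfl

/-- Two rectangular Fock-space operators agreeing on every vector are equal. [folklore] -/
theorem FockMapOp.eq_of_mulVec_eq {m : Type*} {A B : Matrix m (Finset ι) ℂ}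
    (h : ∀ v, A *ᵥ v = B *ᵥ v) : A = B :=
  Matrix.toLin'.injective (LinearMap.ext fun v => by simpa only [Matrix.toLin'_apply] using h v)

/-! ### The one-particle map and the bridge to `ExteriorAlgebra.map` -/

end General

section OneParticle

variable {ι κ μ : Type*}

/-- The one-particle linear map `p_f : ℂ^ι → ℂ^κ`, `e_i ↦ e_{f i}` (a partial isometry for
injective `f`, unitary for bijective `f`), of which `fockMapOp f` is the second quantisation.
[cite: DerezinskiGerard2022, Def. 3.20] -/
def oneParticleMap [Fintype ι] [DecidableEq κ] (f : ι → κ) : (ι → ℂ) →ₗ[ℂ] (κ → ℂ) :=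
  Fintype.linearCombination ℂ fun i => (Pi.single (f i) (1 : ℂ) : κ → ℂ)

/-- `p_f e_i = e_{f i}` (with a scalar). [cite: DerezinskiGerard2022, Def. 3.20] -/
@[simp] theorem oneParticleMap_single [Fintype ι] [DecidableEq ι] [DecidableEq κ] (f : ι → κ)
    (i : ι) (c : ℂ) : oneParticleMap f (Pi.single i c) = Pi.single (f i) c := by
  rw [oneParticleMap, Fintype.linearCombination_apply_single, ← Pi.single_smul', smul_eq_mul,
    mul_one]

/-- `p_{g ∘ f} = p_g ∘ p_f`. [cite: DerezinskiGerard2022, Prop. 3.23 (1)] -/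
theorem oneParticleMap_comp [Fintype ι] [Fintype κ] [DecidableEq κ] [DecidableEq μ] (g : κ → μ)
    (f : ι → κ) : oneParticleMap (g ∘ f) = oneParticleMap g ∘ₗ oneParticleMap f := by
  classical
  refine (Pi.basisFun ℂ ι).ext fun i => ?_
  simp only [Pi.basisFun_apply, LinearMap.coe_comp, Function.comp_apply, oneParticleMap_single]

/-- `p_{id} = 1`. [cite: DerezinskiGerard2022, Prop. 3.23 (1)] -/
theorem oneParticleMap_id [Fintype ι] [DecidableEq ι] :
    oneParticleMap (id : ι → ι) = LinearMap.id := by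
  refine (Pi.basisFun ℂ ι).ext fun i => ?_
  simp only [Pi.basisFun_apply, oneParticleMap_single, id_eq, LinearMap.id_coe]

end OneParticle

section General

variable {ι κ μ : Type*} [LinearOrder ι] [Fintype ι] [LinearOrder κ] [Fintype κ]
  [LinearOrder μ] [Fintype μ]

/-- **`fockMapOp f` is the second quantisation `Γ(p_f)`**: under the identification
`Fock ι ≃ ⋀ ℂ^ι` (`fockExteriorEquiv`, `|t⟩ ↦ e_{t₀} ∧ ⋯ ∧ e_{t_{k-1}}`) it is the exterior-power
functor `ExteriorAlgebra.map p_f`, `e_{t₀} ∧ ⋯ ∧ e_{t_{k-1}} ↦ p_f e_{t₀} ∧ ⋯ ∧ p_f e_{t_{k-1}}`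
(`Γ(p) = ⊕ₙ p^{⊗n}` restricted to the antisymmetric tensors).
[cite: DerezinskiGerard2022, Def. 3.20 and Def. 3.34] -/
theorem fockExteriorEquiv_fockMapOp_mulVec (f : ι → κ) (ψ : Fock ι) :
    fockExteriorEquiv (fockMapOp f *ᵥ ψ) =
      ExteriorAlgebra.map (oneParticleMap f) (fockExteriorEquiv ψ) := by
  have key : ∀ t : Finset ι, fockExteriorEquiv (fockMapOp f *ᵥ (Pi.single t 1 : Fock ι)) =
      ExteriorAlgebra.map (oneParticleMap f) (fockExteriorEquiv (Pi.single t 1 : Fock ι)) := by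
    intro t
    rw [fockMapOp_mulVec_single, FirstQuant.fockExteriorEquiv_prodCreation_vacuum,
      fockExteriorEquiv_single, basisExteriorAlgebra_eq_ιMulti _ rfl,
      ExteriorAlgebra.map_apply_ιMulti]
    congr 1
    funext l
    simp only [Function.comp_apply, Pi.basisFun_apply, oneParticleMap_single]
  have hψ : ψ = ∑ t, ψ t • (Pi.single t 1 : Fock ι) := by
    ext s
    simp [Finset.sum_apply, Pi.single_apply]
  rw [hψ]
  simp only [Matrix.mulVec_sum, Matrix.mulVec_smul, map_sum, map_smul, key]

/-- **`Γ(f)` on creation strings**: `Γ(f) c†_{o₀} ⋯ c†_{o_{N-1}} |∅⟩ = c†_{f o₀} ⋯ c†_{f o_{N-1}} |∅⟩`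
for EVERY string `o` (increasing or not, injective or not) — `Γ(p) Ψ₁ ∧ Ψ₂ = Γ(p)Ψ₁ ∧ Γ(p)Ψ₂`.
[cite: DerezinskiGerard2022, Prop. 3.36] -/
theorem fockMapOp_mulVec_prodCreation_vacuum (f : ι → κ) {N : ℕ} (o : Fin N → ι) :
    fockMapOp f *ᵥ (FirstQuant.prodCreation o *ᵥ (vacuum : Fock ι)) =
      FirstQuant.prodCreation (f ∘ o) *ᵥ (vacuum : Fock κ) := by
  apply fockExteriorEquiv.injective
  rw [fockExteriorEquiv_fockMapOp_mulVec, FirstQuant.fockExteriorEquiv_prodCreation_vacuum,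
    FirstQuant.fockExteriorEquiv_prodCreation_vacuum, ExteriorAlgebra.map_apply_ιMulti]
  congr 1
  funext l
  simp only [Function.comp_apply, oneParticleMap_single]

/-- `Γ(f) |∅⟩ = |∅⟩`. [cite: DerezinskiGerard2022, Def. 3.20] -/
theorem fockMapOp_mulVec_vacuum (f : ι → κ) : fockMapOp f *ᵥ (vacuum : Fock ι) = vacuum := by
  have h := fockMapOp_mulVec_prodCreation_vacuum f (Fin.elim0 : Fin 0 → ι)
  rwa [FirstQuant.prodCreation_zero, FirstQuant.prodCreation_zero, one_mulVec, one_mulVec] at h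

/-! ### Functoriality -/

/-- **Functoriality** `Γ(g ∘ f) = Γ(g) Γ(f)` (for all maps, injective or not):
`Γ(p₂) Γ(p₁) = Γ(p₂ p₁)`. [cite: DerezinskiGerard2022, Prop. 3.23 (1)] -/
theorem fockMapOp_comp (g : κ → μ) (f : ι → κ) :
    fockMapOp (g ∘ f) = fockMapOp g * fockMapOp f := by
  classical
  refine FockMapOp.eq_of_mulVec_eq fun v => ?_
  apply fockExteriorEquiv.injective
  rw [← mulVec_mulVec, fockExteriorEquiv_fockMapOp_mulVec, fockExteriorEquiv_fockMapOp_mulVec,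
    fockExteriorEquiv_fockMapOp_mulVec, oneParticleMap_comp, ← ExteriorAlgebra.map_comp_map]
  rfl

/-- `Γ(id) = 1`. [cite: DerezinskiGerard2022, Prop. 3.23 (1)] -/
theorem fockMapOp_id : fockMapOp (id : ι → ι) = 1 := by
  classical
  refine FockMapOp.eq_of_mulVec_eq fun v => ?_
  apply fockExteriorEquiv.injective
  rw [fockExteriorEquiv_fockMapOp_mulVec, oneParticleMap_id, ExteriorAlgebra.map_id, one_mulVec]
  rfl

/-- For an equivalence, `Γ(e⁻¹) Γ(e) = 1`. [cite: DerezinskiGerard2022, Prop. 3.23 (1)] -/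
theorem fockMapOp_symm_mul_self (e : ι ≃ κ) : fockMapOp e.symm * fockMapOp e = 1 := by
  rw [← fockMapOp_comp, Equiv.symm_comp_self, fockMapOp_id]

/-- For an equivalence, `Γ(e) Γ(e⁻¹) = 1`. [cite: DerezinskiGerard2022, Prop. 3.23 (1)] -/
theorem fockMapOp_self_mul_symm (e : ι ≃ κ) : fockMapOp e * fockMapOp e.symm = 1 := by
  rw [← fockMapOp_comp, Equiv.self_comp_symm, fockMapOp_id]

/-! ### Intertwining with the creation operators -/

/-- **`Γ(f)` implements `c†_i ↦ c†_{f i}`**: `Γ(f) c†_i = c†_{f i} Γ(f)` for every map `f`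
(`Γ(p) a*(w) = a*(p w) Γ(p)`; for site permutations `P c†_i = c†_{π i} P`, Essler et al. (2.35),
(2.41)). [cite: DerezinskiGerard2022, Prop. 3.53 (1)] -/
theorem fockMapOp_mul_creation (f : ι → κ) (i : ι) :
    fockMapOp f * creation i = creation (f i) * fockMapOp f := by
  classical
  refine FockMapOp.eq_of_mulVec_eq fun v => ?_
  apply fockExteriorEquiv.injective
  rw [← mulVec_mulVec, ← mulVec_mulVec, fockExteriorEquiv_fockMapOp_mulVec,
    creation_eq_wedge_holds, creation_eq_wedge_holds, map_mul, ExteriorAlgebra.map_apply_ι,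
    fockExteriorEquiv_fockMapOp_mulVec, oneParticleMap_single]

/-- Iterated form: `Γ(f) C†(o) = C†(f ∘ o) Γ(f)` for a string of creation operators.
[cite: DerezinskiGerard2022, Prop. 3.53 (1)] -/
theorem fockMapOp_mul_prodCreation (f : ι → κ) {N : ℕ} (o : Fin N → ι) :
    fockMapOp f * FirstQuant.prodCreation o = FirstQuant.prodCreation (f ∘ o) * fockMapOp f := by
  induction N with
  | zero =>
      rw [FirstQuant.prodCreation_zero, FirstQuant.prodCreation_zero, Matrix.mul_one,
        Matrix.one_mul]
  | succ N ih =>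
      rw [FirstQuant.prodCreation_succ, FirstQuant.prodCreation_succ, ← Matrix.mul_assoc,
        fockMapOp_mul_creation, Matrix.mul_assoc, ih, ← Matrix.mul_assoc]
      rfl

/-! ### Columns: signed partial permutation matrix; isometry and unitarity -/

omit [Fintype ι] in
/-- `⟨s| Γ(f) |t⟩ = 0` unless `#s = #t` (each column is a `#t`-particle vector). [folklore] -/
theorem fockMapOp_apply_eq_zero_of_card_ne (f : ι → κ) {s : Finset κ} {t : Finset ι}
    (h : s.card ≠ t.card) : fockMapOp f s t = 0 :=
  FirstQuant.isNParticle_prodCreation_vacuum _ s h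

/-- **Pauli principle for `Γ(f)`**: the column at `|t⟩` vanishes when `f` identifies two
orbitals of `t`. [cite: EsslerEtAl2005, §2.1] -/
theorem fockMapOp_mulVec_single_of_not_injOn (f : ι → κ) (t : Finset ι) (hf : ¬Set.InjOn f t) :
    fockMapOp f *ᵥ (Pi.single t 1 : Fock ι) = 0 := by
  rw [fockMapOp_mulVec_single]
  refine FirstQuant.prodCreation_vacuum_of_not_injective _ fun hinj => hf ?_
  intro a ha b hb hab
  obtain ⟨la, rfl⟩ : a ∈ Set.range (t.orderEmbOfFin rfl) := by
    rw [Finset.range_orderEmbOfFin]; exact ha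
  obtain ⟨lb, rfl⟩ : b ∈ Set.range (t.orderEmbOfFin rfl) := by
    rw [Finset.range_orderEmbOfFin]; exact hb
  rw [hinj hab]

/-- **Columns of `Γ(f)`**: if `f` is injective on `t` then `Γ(f)|t⟩ = ε |f '' t⟩` with a sign
`ε = ±1` (the sign of the permutation sorting `(f t₀, …, f t_{k-1})`; antisymmetry of the
creation string). [cite: EsslerEtAl2005, §2.1 eq. (2.2a)] -/
theorem exists_fockMapOp_mulVec_single_eq (f : ι → κ) (t : Finset ι) (hf : Set.InjOn f t) :
    ∃ ε : ℤˣ, fockMapOp f *ᵥ (Pi.single t 1 : Fock ι) =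
      ((ε : ℤ) : ℂ) • (Pi.single (t.image f) 1 : Fock κ) := by
  rw [fockMapOp_mulVec_single]
  have ho : Function.Injective (fun l : Fin t.card => f (t.orderEmbOfFin rfl l)) := by
    intro a b hab
    exact (t.orderEmbOfFin rfl).injective
      (hf (Finset.orderEmbOfFin_mem t rfl a) (Finset.orderEmbOfFin_mem t rfl b) hab)
  obtain ⟨ht, π, hπ⟩ := FirstQuant.exists_perm_eq_orderEmbOfFin_comp _ ho
  have himg : Finset.univ.image (fun l : Fin t.card => f (t.orderEmbOfFin rfl l)) = t.image f := by
    ext k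
    simp only [Finset.mem_image, Finset.mem_univ, true_and]
    constructor
    · rintro ⟨l, rfl⟩
      exact ⟨_, Finset.orderEmbOfFin_mem t rfl l, rfl⟩
    · rintro ⟨i, hi, rfl⟩
      obtain ⟨l, rfl⟩ : i ∈ Set.range (t.orderEmbOfFin rfl) := by
        rw [Finset.range_orderEmbOfFin]; exact hi
      exact ⟨l, rfl⟩
  refine ⟨Equiv.Perm.sign π, ?_⟩
  rw [hπ, FirstQuant.prodCreation_vacuum_perm, FirstQuant.prodCreation_orderEmbOfFin_vacuum]
  congr 1
  rw [himg]

/-- Entries of `Γ(f)` are supported on `s = f '' t` (a signed partial permutation matrix of the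
configurations). [folklore] -/
theorem fockMapOp_apply_eq_zero_of_ne_image (f : ι → κ) {s : Finset κ} {t : Finset ι}
    (h : s ≠ t.image f) : fockMapOp f s t = 0 := by
  have hcol : fockMapOp f s t = (fockMapOp f *ᵥ (Pi.single t 1 : Fock ι)) s := by
    rw [Matrix.mulVec_single_one]; rfl
  rw [hcol]
  by_cases hf : Set.InjOn f t
  · obtain ⟨ε, hε⟩ := exists_fockMapOp_mulVec_single_eq f t hf
    rw [hε, Pi.smul_apply, Pi.single_eq_of_ne h, smul_zero]
  · rw [fockMapOp_mulVec_single_of_not_injOn f t hf, Pi.zero_apply]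

/-- The nonzero entries of `Γ(f)` are signs: `⟨f '' t| Γ(f) |t⟩ = ±1` when `f` is injective on
`t`. [cite: EsslerEtAl2005, §2.1 eq. (2.2a)] -/
theorem exists_fockMapOp_apply_image_eq (f : ι → κ) (t : Finset ι) (hf : Set.InjOn f t) :
    ∃ ε : ℤˣ, fockMapOp f (t.image f) t = ((ε : ℤ) : ℂ) := by
  obtain ⟨ε, hε⟩ := exists_fockMapOp_mulVec_single_eq f t hf
  refine ⟨ε, ?_⟩
  have hcol : fockMapOp f (t.image f) t = (fockMapOp f *ᵥ (Pi.single t 1 : Fock ι)) (t.image f) := by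
    rw [Matrix.mulVec_single_one]; rfl
  rw [hcol, hε, Pi.smul_apply, Pi.single_eq_same, smul_eq_mul, mul_one]

/-- The entries of `Γ(f)` are real (indeed in `{0, ±1}`). [folklore] -/
theorem star_fockMapOp_apply (f : ι → κ) (s : Finset κ) (t : Finset ι) :
    star (fockMapOp f s t) = fockMapOp f s t := by
  by_cases hs : s = t.image f
  · subst hs
    by_cases hf : Set.InjOn f t
    · obtain ⟨ε, hε⟩ := exists_fockMapOp_apply_image_eq f t hf
      rw [hε, Complex.star_def, ← Complex.ofReal_intCast, Complex.conj_ofReal]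
    · have h0 : fockMapOp f (t.image f) t = 0 := by
        have hcol : fockMapOp f (t.image f) t =
            (fockMapOp f *ᵥ (Pi.single t 1 : Fock ι)) (t.image f) := by
          rw [Matrix.mulVec_single_one]; rfl
        rw [hcol, fockMapOp_mulVec_single_of_not_injOn f t hf, Pi.zero_apply]
      rw [h0, star_zero]
  · rw [fockMapOp_apply_eq_zero_of_ne_image f hs, star_zero]

/-- **`Γ(f)` is an isometry for injective `f`**: `Γ(f)ᴴ Γ(f) = 1` (its columns `±|f '' t⟩` are
orthonormal). [cite: DerezinskiGerard2022, §3.2.2 (Γ(p) is isometric iff p is)] -/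
theorem conjTranspose_fockMapOp_mul_self (f : ι → κ) (hf : Function.Injective f) :
    (fockMapOp f)ᴴ * fockMapOp f = 1 := by
  ext t' t
  rw [Matrix.mul_apply, Matrix.one_apply]
  by_cases htt : t' = t
  · subst htt
    rw [if_pos rfl, Finset.sum_eq_single (t'.image f)]
    · obtain ⟨ε, hε⟩ := exists_fockMapOp_apply_image_eq f t' hf.injOn
      rw [conjTranspose_apply, hε, Complex.star_def, ← Complex.ofReal_intCast,
        Complex.conj_ofReal, ← Complex.ofReal_mul, ← Int.cast_mul, ← Units.val_mul,
        Int.units_mul_self, Units.val_one, Int.cast_one, Complex.ofReal_one]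
    · intro s _ hs
      rw [fockMapOp_apply_eq_zero_of_ne_image f hs, mul_zero]
    · intro h
      exact absurd (Finset.mem_univ _) h
  · rw [if_neg htt]
    refine Finset.sum_eq_zero fun s _ => ?_
    by_cases hs : s = t.image f
    · have hs' : s ≠ t'.image f := fun h' =>
        htt (Finset.image_injective hf (h'.symm.trans hs))
      rw [conjTranspose_apply, fockMapOp_apply_eq_zero_of_ne_image f hs', star_zero, zero_mul]
    · rw [fockMapOp_apply_eq_zero_of_ne_image f hs, mul_zero]

/-- For an equivalence `e`, `Γ(e)ᴴ = Γ(e⁻¹)` (`Γ(u)* = Γ(u*) = Γ(u⁻¹)` for unitary `u`).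
[cite: DerezinskiGerard2022, §3.2.2] -/
theorem conjTranspose_fockMapOp (e : ι ≃ κ) : (fockMapOp e)ᴴ = fockMapOp e.symm := by
  calc (fockMapOp e)ᴴ = (fockMapOp e)ᴴ * (fockMapOp e * fockMapOp e.symm) := by
        rw [fockMapOp_self_mul_symm, Matrix.mul_one]
    _ = fockMapOp e.symm := by
        rw [← Matrix.mul_assoc, conjTranspose_fockMapOp_mul_self _ e.injective, Matrix.one_mul]

/-- **`Γ(f)` is unitary for bijective `f`** (co-isometry half): `Γ(f) Γ(f)ᴴ = 1`.
[cite: DerezinskiGerard2022, §3.2.2 (Γ(p) is unitary iff p is)] -/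
theorem fockMapOp_mul_conjTranspose_self (f : ι → κ) (hf : Function.Bijective f) :
    fockMapOp f * (fockMapOp f)ᴴ = 1 := by
  rw [show f = ⇑(Equiv.ofBijective f hf) from rfl, conjTranspose_fockMapOp,
    fockMapOp_self_mul_symm]

/-- **`Γ(f)` is unitary** for a bijection `f : ι → ι` of the orbitals (Essler et al.: the site
permutation and shift operators are unitary, (2.37), (2.42)).
[cite: EsslerEtAl2005, §2.2.2 eq. (2.42)] -/
theorem fockMapOp_mem_unitaryGroup (f : ι → ι) (hf : Function.Bijective f) :
    fockMapOp f ∈ Matrix.unitaryGroup (Finset ι) ℂ := by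
  rw [Matrix.mem_unitaryGroup_iff, star_eq_conjTranspose]
  exact fockMapOp_mul_conjTranspose_self f hf

/-- **Conjugation of creation operators**: `Γ(f) c†_i Γ(f)ᴴ = c†_{f i}` for bijective `f`
(`P c†_i P† = c†_{π i}`). [cite: EsslerEtAl2005, §2.2.1 eq. (2.35)] -/
theorem fockMapOp_mul_creation_mul_conjTranspose (f : ι → κ) (hf : Function.Bijective f) (i : ι) :
    fockMapOp f * creation i * (fockMapOp f)ᴴ = creation (f i) := by
  rw [fockMapOp_mul_creation, Matrix.mul_assoc, fockMapOp_mul_conjTranspose_self f hf,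
    Matrix.mul_one]

/-- **Conjugation of annihilation operators**: `Γ(f) c_i Γ(f)ᴴ = c_{f i}` for bijective `f`
(`a(w) Γ(p) = Γ(p) a(p* w)`). [cite: DerezinskiGerard2022, Prop. 3.53 (1)] -/
theorem fockMapOp_mul_annihilation_mul_conjTranspose (f : ι → κ) (hf : Function.Bijective f)
    (i : ι) : fockMapOp f * annihilation i * (fockMapOp f)ᴴ = annihilation (f i) := by
  have h := congr_arg conjTranspose (fockMapOp_mul_creation_mul_conjTranspose f hf i)
  rwa [conjTranspose_mul, conjTranspose_mul, conjTranspose_conjTranspose, creation_conjTranspose,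
    creation_conjTranspose, ← Matrix.mul_assoc] at h

/-- `Γ(f) c_i = c_{f i} Γ(f)` for bijective `f`. [cite: EsslerEtAl2005, §2.2.1 eq. (2.34)] -/
theorem fockMapOp_mul_annihilation (f : ι → κ) (hf : Function.Bijective f) (i : ι) :
    fockMapOp f * annihilation i = annihilation (f i) * fockMapOp f := by
  calc fockMapOp f * annihilation i
      = fockMapOp f * annihilation i * ((fockMapOp f)ᴴ * fockMapOp f) := by
        rw [conjTranspose_fockMapOp_mul_self f hf.injective, Matrix.mul_one]
    _ = annihilation (f i) * fockMapOp f := by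
        rw [← Matrix.mul_assoc, fockMapOp_mul_annihilation_mul_conjTranspose f hf]

/-! ### Particle number -/

/-- `Γ(f)` maps `N`-particle vectors to `N`-particle vectors (`[Γ(p), N] = 0`).
[cite: DerezinskiGerard2022, Def. 3.20] -/
theorem IsNParticle.fockMapOp_mulVec {N : ℕ} {ψ : Fock ι} (hψ : IsNParticle N ψ) (f : ι → κ) :
    IsNParticle N (fockMapOp f *ᵥ ψ) := by
  intro s hs
  simp only [Matrix.mulVec, dotProduct]
  refine Finset.sum_eq_zero fun t _ => ?_
  by_cases ht : t.card = N
  · rw [fockMapOp_apply_eq_zero_of_card_ne f (by rw [ht]; exact hs), zero_mul]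
  · rw [hψ t ht, mul_zero]

/-- `Γ(f)` maps the `N`-particle sector into the `N`-particle sector. [folklore] -/
theorem fockMapOp_mulVec_mem_nParticleSubmodule {N : ℕ} {ψ : Fock ι}
    (hψ : ψ ∈ nParticleSubmodule N) (f : ι → κ) :
    fockMapOp f *ᵥ ψ ∈ (nParticleSubmodule N : Submodule ℂ (Fock κ)) :=
  IsNParticle.fockMapOp_mulVec hψ f

/-- `Γ(f)` intertwines the total number operators: `Γ(f) N = N Γ(f)`.
[cite: DerezinskiGerard2022, Def. 3.20] -/
theorem fockMapOp_mul_totalNumberOp (f : ι → κ) :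
    fockMapOp f * (totalNumberOp : Matrix (Finset ι) (Finset ι) ℂ) =
      (totalNumberOp : Matrix (Finset κ) (Finset κ) ℂ) * fockMapOp f := by
  rw [totalNumberOp_eq_diagonal, totalNumberOp_eq_diagonal]
  ext s t
  rw [Matrix.mul_diagonal, Matrix.diagonal_mul]
  by_cases h : s.card = t.card
  · rw [h, mul_comm]
  · rw [fockMapOp_apply_eq_zero_of_card_ne f h, zero_mul, mul_zero]

/-- For `f : ι → ι`, `Γ(f)` commutes with the total number operator. [folklore] -/
theorem fockMapOp_commute_totalNumberOp (f : ι → ι) : Commute (fockMapOp f) totalNumberOp :=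
  fockMapOp_mul_totalNumberOp f

/-- From a conjugation identity `Γ A Γᴴ = B` and `Γᴴ Γ = 1` to the intertwining relation
`Γ A = B Γ`. [folklore] -/
theorem FockMapOp.mul_eq_mul_of_conj_eq {m : Type*} [Fintype m] (Γ : Matrix m (Finset ι) ℂ)
    (hΓ : Γᴴ * Γ = 1) {A : Matrix (Finset ι) (Finset ι) ℂ} {B : Matrix m m ℂ}
    (h : Γ * A * Γᴴ = B) : Γ * A = B * Γ := by
  calc Γ * A = Γ * A * (Γᴴ * Γ) := by rw [hΓ, Matrix.mul_one]
    _ = Γ * A * Γᴴ * Γ := by rw [Matrix.mul_assoc (Γ * A)]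
    _ = B * Γ := by rw [h]

end General

/-! ### Equivalences: `fockMapOp e` is the tree's signed permutation matrix `relabelMatrix e` -/

section Relabel

variable {ι κ : Type*} [LinearOrder ι] [Fintype ι] [LinearOrder κ] [Fintype κ]

/-- **Identification with `relabelMatrix`** (`HyperoctahedralFockAction`): for an orbital
BIJECTION `e`, the creation-string operator `fockMapOp e` is the signed permutation matrix
`|t⟩ ↦ ε_e(t) |e t⟩` of `FermionRelabelling`/`HyperoctahedralFockAction` — both commute with
every `c†_i ↦ c†_{e i}` and fix the vacuum, so they agree by the uniqueness principle
`eq_one_of_commute_creation_of_mulVec_vacuum` (cyclicity of the vacuum). Hence the whole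
`relabel`/`relabelMatrix` API (covariance of the Hubbard Hamiltonian, Gibbs states, the
hyperoctahedral action) applies to `fockMapOp` of an equivalence.
[cite: BratteliRobinsonII1997, §5.2.2, Thm. 5.2.5] -/
theorem fockMapOp_equiv (e : ι ≃ κ) : fockMapOp e = relabelMatrix e := by
  have hV : (relabelMatrix e)ᴴ * fockMapOp e = 1 := by
    apply eq_one_of_commute_creation_of_mulVec_vacuum
    · intro i
      have h1 : (relabelMatrix e)ᴴ * creation (e i) = creation i * (relabelMatrix e)ᴴ := by
        rw [← relabelMatrix_mul_creation_mul_conjTranspose e i, ← Matrix.mul_assoc,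
          ← Matrix.mul_assoc, conjTranspose_mul_relabelMatrix, Matrix.one_mul]
      rw [Matrix.mul_assoc, fockMapOp_mul_creation, ← Matrix.mul_assoc, h1, Matrix.mul_assoc]
    · rw [← mulVec_mulVec, fockMapOp_mulVec_vacuum, ← relabelMatrix_mulVec_vacuum e, mulVec_mulVec,
        conjTranspose_mul_relabelMatrix, one_mulVec]
  calc fockMapOp e = relabelMatrix e * ((relabelMatrix e)ᴴ * fockMapOp e) := by
        rw [← Matrix.mul_assoc, relabelMatrix_mul_conjTranspose, Matrix.one_mul]
    _ = relabelMatrix e := by rw [hV, Matrix.mul_one]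

/-- **Explicit columns for a bijection**: `Γ(e) |t⟩ = ε_e(t) |e t⟩` with the relabelling sign
`ε_e(t) = relabelSign e t = (-1)^{#inversions of e on t}`. [cite: BratteliRobinsonII1997, §5.2.2] -/
theorem fockMapOp_equiv_mulVec_single (e : ι ≃ κ) (t : Finset ι) :
    fockMapOp e *ᵥ (Pi.single t 1 : Fock ι) =
      relabelSign e t • (Pi.single (e.finsetCongr t) 1 : Fock κ) := by
  rw [fockMapOp_equiv]
  ext s
  simp only [mulVec_single_one, col_apply, relabelMatrix, Pi.smul_apply, Pi.single_apply,
    smul_eq_mul, mul_ite, mul_one, mul_zero]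

/-- The creation string of a relabelled increasing enumeration:
`c†_{e t₀} ⋯ c†_{e t_{k-1}} |∅⟩ = ε_e(t) |e t⟩`. [cite: BratteliRobinsonII1997, §5.2.2] -/
theorem prodCreation_equiv_orderEmbOfFin_vacuum (e : ι ≃ κ) (t : Finset ι) :
    FirstQuant.prodCreation (fun l : Fin t.card => e (t.orderEmbOfFin rfl l)) *ᵥ (vacuum : Fock κ) =
      relabelSign e t • (Pi.single (e.finsetCongr t) 1 : Fock κ) := by
  rw [← fockMapOp_mulVec_single, fockMapOp_equiv_mulVec_single]

/-- `relabel e` is conjugation by `fockMapOp e`. [cite: BratteliRobinsonII1997, §5.2.2, Thm. 5.2.5] -/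
theorem relabel_eq_fockMapOp_mul (e : ι ≃ κ) (a : Matrix (Finset ι) (Finset ι) ℂ) :
    relabel e a = fockMapOp e * a * (fockMapOp e)ᴴ := by
  rw [fockMapOp_equiv, relabel_eq_relabelMatrix_mul]

end Relabel

/-! ### Site bijections of the Hubbard model: covariance of `H`, `N`, `S^z` and the sectors -/

section Hubbard

open HubbardWave0

variable {Λ Λ' : Type*} [LinearOrder Λ] [LinearOrder Λ'] [Fintype Λ] [Fintype Λ']

/-- **`Γ_f` intertwines the Hubbard Hamiltonians of isomorphic graphs**: if the site bijection
`f` carries the adjacency of `G` onto that of `G'` then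
`Γ_f H_G(t,U) = H_{G'}(t,U) Γ_f` (`Γ_f = fockMapOp (Orb.mapEquiv f)`); for an automorphism
(`G' = G`) the second-quantised symmetry commutes with `H`. [cite: EsslerEtAl2005, §2.2.2] -/
theorem fockMapOp_mapEquiv_mul_hamiltonian (G : SimpleGraph Λ) [DecidableRel G.Adj]
    (G' : SimpleGraph Λ') [DecidableRel G'.Adj] (f : Λ ≃ Λ')
    (hG : ∀ x y, G'.Adj (f x) (f y) ↔ G.Adj x y) (t U : ℝ) :
    fockMapOp (Orb.mapEquiv f) * hamiltonian G t U =
      hamiltonian G' t U * fockMapOp (Orb.mapEquiv f) :=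
  FockMapOp.mul_eq_mul_of_conj_eq _
    (conjTranspose_fockMapOp_mul_self _ (Orb.mapEquiv f).injective)
    ((relabel_eq_fockMapOp_mul _ _).symm.trans (relabel_hamiltonian G G' f hG t U))

/-- `Γ_f N = N Γ_f` for a site bijection `f`. [folklore] -/
theorem fockMapOp_mapEquiv_mul_totalNumber (f : Λ ≃ Λ') :
    fockMapOp (Orb.mapEquiv f) * (totalNumber : Matrix (Finset (Orb Λ)) (Finset (Orb Λ)) ℂ) =
      (totalNumber : Matrix (Finset (Orb Λ')) (Finset (Orb Λ')) ℂ) * fockMapOp (Orb.mapEquiv f) :=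
  FockMapOp.mul_eq_mul_of_conj_eq _
    (conjTranspose_fockMapOp_mul_self _ (Orb.mapEquiv f).injective)
    ((relabel_eq_fockMapOp_mul _ _).symm.trans (relabel_mapEquiv_totalNumber f))

/-- `Γ_f S^z = S^z Γ_f` for a site bijection `f` (spin untouched). [folklore] -/
theorem fockMapOp_mapEquiv_mul_spinZ (f : Λ ≃ Λ') :
    fockMapOp (Orb.mapEquiv f) * (spinZ : Matrix (Finset (Orb Λ)) (Finset (Orb Λ)) ℂ) =
      (spinZ : Matrix (Finset (Orb Λ')) (Finset (Orb Λ')) ℂ) * fockMapOp (Orb.mapEquiv f) := by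
  -- `Γ_f S^z Γ_f⁻¹ = S^z` (the `Λ ≃ Λ'` version of `relabel_mapEquiv_spinZ`)
  have hS : relabel (Orb.mapEquiv f) (spinZ : Matrix (Finset (Orb Λ)) (Finset (Orb Λ)) ℂ) =
      spinZ := by
    rw [spinZ, spinZ, map_smul, map_sum]
    congr 1
    rw [← f.sum_comp]
    refine Finset.sum_congr rfl fun x _ => ?_
    rw [map_sub, relabel_mapEquiv_numberOp, relabel_mapEquiv_numberOp]
  exact FockMapOp.mul_eq_mul_of_conj_eq _
    (conjTranspose_fockMapOp_mul_self _ (Orb.mapEquiv f).injective)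
    ((relabel_eq_fockMapOp_mul _ _).symm.trans hS)

/-- `Γ_f` maps the joint sector `(N, S^z = M)` over `Λ` into the one over `Λ'`. [folklore] -/
theorem fockMapOp_mapEquiv_mulVec_mem_szSector (f : Λ ≃ Λ') {N : ℕ} {M : ℝ} {ψ : Fock (Orb Λ)}
    (hψ : ψ ∈ szSector N M) :
    fockMapOp (Orb.mapEquiv f) *ᵥ ψ ∈ szSector (Λ := Λ') N M := by
  rw [mem_szSector_iff] at hψ ⊢
  refine ⟨hψ.1.fockMapOp_mulVec _, ?_⟩
  rw [mulVec_mulVec, ← fockMapOp_mapEquiv_mul_spinZ, ← mulVec_mulVec, hψ.2, mulVec_smul]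

/-- `Γ_f` is injective on vectors (an isometry). [folklore] -/
theorem fockMapOp_mulVec_ne_zero {ι κ : Type*} [LinearOrder ι] [Fintype ι] [LinearOrder κ]
    [Fintype κ] (g : ι → κ) (hg : Function.Injective g) {ψ : Fock ι} (hψ : ψ ≠ 0) :
    fockMapOp g *ᵥ ψ ≠ 0 := by
  intro h0
  apply hψ
  have h := congr_arg (fun v => (fockMapOp g)ᴴ *ᵥ v) h0
  simpa only [mulVec_mulVec, conjTranspose_fockMapOp_mul_self g hg, one_mulVec, mulVec_zero]
    using h

/-- **Sector ground states are permuted by lattice symmetries**: for a graph automorphism `f`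
of `G`, `Γ_f` maps every `(N, S^z = M)`-sector ground state of `H_G(t,U)` to a ground state of
the same sector and energy. [cite: EsslerEtAl2005, §2.2.2] -/
theorem IsGroundStateInSector.fockMapOp_mapEquiv_mulVec (G : SimpleGraph Λ) [DecidableRel G.Adj]
    (f : Equiv.Perm Λ) (hG : ∀ x y, G.Adj (f x) (f y) ↔ G.Adj x y) {t U : ℝ} {N : ℕ} {M : ℝ}
    {ψ : Fock (Orb Λ)} (hψ : IsGroundStateInSector (hamiltonian G t U) N M ψ) :
    IsGroundStateInSector (hamiltonian G t U) N M (fockMapOp (Orb.mapEquiv f) *ᵥ ψ) := by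
  obtain ⟨hmem, hne, heig⟩ := hψ
  refine ⟨fockMapOp_mapEquiv_mulVec_mem_szSector f hmem,
    fockMapOp_mulVec_ne_zero _ (Orb.mapEquiv f).injective hne, ?_⟩
  rw [mulVec_mulVec, ← fockMapOp_mapEquiv_mul_hamiltonian G G f hG, ← mulVec_mulVec, heig,
    mulVec_smul]

end Hubbard

end Literature.MathematicalPhysics.QuantumLattice
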